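import Mathlib
import Summits.Ventures.HodgeRepro2.Tier7.Line3.OneVectorProjector

/-!
# Tier7/Line3/OneVectorProjectorRange — the range of `R(f)` is exactly the set of images of `u` under the
equivariant maps `τ → π` (seat t7-L1-p2, gen 3; t7-crit-2's record (1) on p677826, STATUS l. 15296, made exact)

`OneVectorProjector` (p677826) proves that the integrated one-vector coefficient `R(f)`, `f = d · ⟪τ g u, u⟫`, is an
orthogonal projection on every strongly continuous unitary representation `π` of the compact group on a Hilbert
space `H`, and that `R(f) x` is the image of `u` under the equivariant map `PhiLM x : V →ₗ[ℂ] H`. THIS FILE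
identifies the range precisely: **`y ∈ range R(f) ↔ ∃ ι : V →ₗ[ℂ] H equivariant, ι u = y`** (`‖u‖ = 1`) — no
closure, no span: the set of images of `u` under the equivariant maps is already the whole range (⊆ by
`integratedForm_eq_PhiFun` + `pi_PhiFun`; ⊇ by `integratedForm_map_eq` with `v = u`). Hence the orthogonal
projection of any `x` onto that subspace is `R(f) x` (`starProjection_range_Rop_apply`). Nothing here is about the
real objects or (N); the dictionary is in words as for p677826. No sorry; axioms ⊆ {propext, Classical.choice,
Quot.sound}.
-/

namespace Summit.Ventures.HodgeRepro2.Tier7.Line3.OneVectorProjectorRange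

open MeasureTheory
open scoped InnerProductSpace
open Summit.Ventures.HodgeRepro2.T7SupportIntegratedForm (integratedForm)
open Summit.Ventures.HodgeRepro2.Tier7.Line3.SchurProjector (IsIrreducible)
open Summit.Ventures.HodgeRepro2.Tier7.Line3.OneVectorProjector

variable {G : Type*} [Group G] [TopologicalSpace G] [IsTopologicalGroup G] [CompactSpace G]
  [MeasurableSpace G] [BorelSpace G] (μ : Measure G)
variable {V : Type*} [NormedAddCommGroup V] [InnerProductSpace ℂ V] [FiniteDimensional ℂ V] [CompleteSpace V]
variable {H : Type*} [NormedAddCommGroup H] [InnerProductSpace ℂ H] [CompleteSpace H]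

omit [TopologicalSpace G] [IsTopologicalGroup G] [CompactSpace G] [MeasurableSpace G] [BorelSpace G]
  [FiniteDimensional ℂ V] [CompleteSpace V] [CompleteSpace H] in
/-- `ι : V →ₗ[ℂ] H` is equivariant: `ι (τ g v) = π g (ι v)` — an embedded copy of `τ` inside `π` (or `0`). -/
def IsEquivariantMap (τ : G →* (V →L[ℂ] V)) (π : G →* (H →ₗ[ℂ] H)) (ι : V →ₗ[ℂ] H) : Prop :=
  ∀ g v, ι (τ g v) = π g (ι v)

omit [FiniteDimensional ℂ V] [CompleteSpace V] in
/-- `PhiLM x` is equivariant (`OneVectorProjector.pi_PhiFun`). -/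
theorem isEquivariantMap_PhiLM [IsFiniteMeasure μ] [μ.IsMulLeftInvariant] {τ : G →* (V →L[ℂ] V)}
    (hτ : Continuous τ) (hτu : SchurProjector.IsUnitaryRep τ) {π : G →* (H →ₗ[ℂ] H)}
    (hπ : T7SupportWeightTorusOrbital.IsUnitaryRep π) (hc : ∀ x, Continuous fun g => π g x) (u : V) (x : H) :
    IsEquivariantMap τ π (PhiLM μ hτ hπ hc u x) := fun g v => by
  rw [PhiLM_apply, PhiLM_apply, pi_PhiFun μ hτ hτu hπ hc u x g v]

/-- **`R(f)` fixes the `u`-vector of every embedded copy**: `R(f) (ι u) = ι u` for `‖u‖ = 1`. -/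
theorem Rop_map_u [IsProbabilityMeasure μ] [μ.IsMulLeftInvariant] {τ : G →* (V →L[ℂ] V)} (hτ : Continuous τ)
    (hτu : SchurProjector.IsUnitaryRep τ) (hτi : IsIrreducible τ) {π : G →* (H →ₗ[ℂ] H)}
    (hπ : T7SupportWeightTorusOrbital.IsUnitaryRep π) (hc : ∀ x, Continuous fun g => π g x) (u : V)
    (hu : ⟪u, u⟫_ℂ = 1) {ι : V →ₗ[ℂ] H} (hι : IsEquivariantMap τ π ι) : Rop μ hτ hπ hc u (ι u) = ι u := by
  rw [Rop_apply, integratedForm_map_eq μ hτ hτu hτi u ι hι u, hu, one_smul]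

/-- every embedded copy's `u`-vector lies in the range of `R(f)`. -/
theorem map_u_mem_range_Rop [IsProbabilityMeasure μ] [μ.IsMulLeftInvariant] {τ : G →* (V →L[ℂ] V)}
    (hτ : Continuous τ) (hτu : SchurProjector.IsUnitaryRep τ) (hτi : IsIrreducible τ) {π : G →* (H →ₗ[ℂ] H)}
    (hπ : T7SupportWeightTorusOrbital.IsUnitaryRep π) (hc : ∀ x, Continuous fun g => π g x) (u : V)
    (hu : ⟪u, u⟫_ℂ = 1) {ι : V →ₗ[ℂ] H} (hι : IsEquivariantMap τ π ι) :
    ι u ∈ LinearMap.range (Rop μ hτ hπ hc u : H →ₗ[ℂ] H) :=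
  ⟨ι u, Rop_map_u μ hτ hτu hτi hπ hc u hu hι⟩

/-- **THE RANGE OF `R(f)`, EXACTLY**: `y ∈ range R(f) ↔ y = ι u` for some equivariant `ι : V →ₗ[ℂ] H` (`‖u‖ = 1`). -/
theorem mem_range_Rop_iff [IsProbabilityMeasure μ] [μ.IsMulLeftInvariant] {τ : G →* (V →L[ℂ] V)}
    (hτ : Continuous τ) (hτu : SchurProjector.IsUnitaryRep τ) (hτi : IsIrreducible τ) {π : G →* (H →ₗ[ℂ] H)}
    (hπ : T7SupportWeightTorusOrbital.IsUnitaryRep π) (hc : ∀ x, Continuous fun g => π g x) (u : V)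
    (hu : ⟪u, u⟫_ℂ = 1) (y : H) :
    y ∈ LinearMap.range (Rop μ hτ hπ hc u : H →ₗ[ℂ] H) ↔
      ∃ ι : V →ₗ[ℂ] H, IsEquivariantMap τ π ι ∧ ι u = y := by
  constructor
  · rintro ⟨x, rfl⟩
    exact ⟨PhiLM μ hτ hπ hc u x, isEquivariantMap_PhiLM μ hτ hτu hπ hc u x, rfl⟩
  · rintro ⟨ι, hι, rfl⟩
    exact map_u_mem_range_Rop μ hτ hτu hτi hπ hc u hu hι

/-- the set of images of `u` under the equivariant maps, as a submodule (it is the range of `R(f)`). -/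
noncomputable def uImages [IsProbabilityMeasure μ] [μ.IsMulLeftInvariant] {τ : G →* (V →L[ℂ] V)}
    (hτ : Continuous τ) (hτu : SchurProjector.IsUnitaryRep τ) (hτi : IsIrreducible τ) {π : G →* (H →ₗ[ℂ] H)}
    (hπ : T7SupportWeightTorusOrbital.IsUnitaryRep π) (hc : ∀ x, Continuous fun g => π g x) (u : V)
    (hu : ⟪u, u⟫_ℂ = 1) : Submodule ℂ H :=
  (LinearMap.range (Rop μ hτ hπ hc u : H →ₗ[ℂ] H)).copy {y | ∃ ι : V →ₗ[ℂ] H, IsEquivariantMap τ π ι ∧ ι u = y}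
    (by
      ext y
      exact (mem_range_Rop_iff μ hτ hτu hτi hπ hc u hu y).symm)

/-- `uImages` is the set of images of `u` under the equivariant maps. -/
theorem mem_uImages_iff [IsProbabilityMeasure μ] [μ.IsMulLeftInvariant] {τ : G →* (V →L[ℂ] V)}
    (hτ : Continuous τ) (hτu : SchurProjector.IsUnitaryRep τ) (hτi : IsIrreducible τ) {π : G →* (H →ₗ[ℂ] H)}
    (hπ : T7SupportWeightTorusOrbital.IsUnitaryRep π) (hc : ∀ x, Continuous fun g => π g x) (u : V)
    (hu : ⟪u, u⟫_ℂ = 1) (y : H) :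
    y ∈ uImages μ hτ hτu hτi hπ hc u hu ↔ ∃ ι : V →ₗ[ℂ] H, IsEquivariantMap τ π ι ∧ ι u = y := Iff.rfl

/-- `range R(f) = uImages` as submodules. -/
theorem range_Rop_eq [IsProbabilityMeasure μ] [μ.IsMulLeftInvariant] {τ : G →* (V →L[ℂ] V)} (hτ : Continuous τ)
    (hτu : SchurProjector.IsUnitaryRep τ) (hτi : IsIrreducible τ) {π : G →* (H →ₗ[ℂ] H)}
    (hπ : T7SupportWeightTorusOrbital.IsUnitaryRep π) (hc : ∀ x, Continuous fun g => π g x) (u : V)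
    (hu : ⟪u, u⟫_ℂ = 1) :
    LinearMap.range (Rop μ hτ hπ hc u : H →ₗ[ℂ] H) = uImages μ hτ hτu hτi hπ hc u hu :=
  (Submodule.copy_eq _ _ _).symm

/-- `uImages` has an orthogonal projection (it is the range of the idempotent bounded operator `R(f)`). -/
theorem hasOrthogonalProjection_uImages [IsProbabilityMeasure μ] [μ.IsMulLeftInvariant] {τ : G →* (V →L[ℂ] V)}
    (hτ : Continuous τ) (hτu : SchurProjector.IsUnitaryRep τ) (hτi : IsIrreducible τ) {π : G →* (H →ₗ[ℂ] H)}
    (hπ : T7SupportWeightTorusOrbital.IsUnitaryRep π) (hc : ∀ x, Continuous fun g => π g x) (u : V)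
    (hu : ⟪u, u⟫_ℂ = 1) : (uImages μ hτ hτu hτi hπ hc u hu).HasOrthogonalProjection := by
  rw [← range_Rop_eq μ hτ hτu hτi hπ hc u hu]
  exact ContinuousLinearMap.IsIdempotentElem.hasOrthogonalProjection_range (isIdempotentElem_Rop μ hτ hτu hτi hπ hc u hu)

/-- **the orthogonal projection of `x` onto the images-of-`u` subspace is `R(f) x`**. -/
theorem starProjection_uImages_apply [μ.IsHaarMeasure] [IsProbabilityMeasure μ] {τ : G →* (V →L[ℂ] V)}
    (hτ : Continuous τ) (hτu : SchurProjector.IsUnitaryRep τ) (hτi : IsIrreducible τ) {π : G →* (H →ₗ[ℂ] H)}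
    (hπ : T7SupportWeightTorusOrbital.IsUnitaryRep π) (hc : ∀ x, Continuous fun g => π g x) (u : V)
    (hu : ⟪u, u⟫_ℂ = 1) (x : H) :
    haveI := hasOrthogonalProjection_uImages μ hτ hτu hτi hπ hc u hu
    (uImages μ hτ hτu hτi hπ hc u hu).starProjection x = Rop μ hτ hπ hc u x := by
  haveI := hasOrthogonalProjection_uImages μ hτ hτu hτi hπ hc u hu
  refine Submodule.eq_starProjection_of_mem_orthogonal ?_ ?_
  · rw [← range_Rop_eq μ hτ hτu hτi hπ hc u hu]
    exact LinearMap.mem_range_self _ x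
  · rw [← range_Rop_eq μ hτ hτu hτi hπ hc u hu, Submodule.mem_orthogonal]
    intro y hy
    have hsym := (isSelfAdjoint_Rop μ hτ hτu hπ hc u).isSymmetric
    have h1 : ⟪y, x - Rop μ hτ hπ hc u x⟫_ℂ = ⟪y, x⟫_ℂ - ⟪Rop μ hτ hπ hc u y, x⟫_ℂ := by
      rw [inner_sub_right]
      have := hsym y x
      simp only [ContinuousLinearMap.coe_coe] at this
      rw [this]
    rw [h1, Rop_apply_of_mem_range μ hτ hτu hτi hπ hc u hu hy, sub_self]

end Summit.Ventures.HodgeRepro2.Tier7.Line3.OneVectorProjectorRange
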